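import Literature.NumberTheory.CubicFields.ThreeTorsionBridge
import HarnessLib

/-!
# Hasse's class-field-theoretic dictionary: cubic fields of fundamental discriminant `D` and the 3-torsion of `Cl(ℚ(√D))`

Topic `Literature/NumberTheory/CubicFields`, a NAMED FACT (D-0014) completing
`ThreeTorsionBridge.lean`, where the dictionary is so far an inline HYPOTHESIS (`hCFT`) of
`btt_threeTorsion_sum_neg_iff_fundCubicFieldCount`.

Bhargava–Taniguchi–Thorne 2023, p. 3: by class field theory (Hasse 1930), the cubic fields `K`
with `Disc(K) = D` fundamental correspond to the index-`3` subgroups of `Cl(ℚ(√D))`, so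
`#Cl₃(D) = 2 · #{K : Disc(K) = D} + 1`. (Hasse, *Arithmetische Theorie der kubischen Zahlkörper
auf klassenkörpertheoretischer Grundlage*, Math. Z. 31 (1930) 565–582; Davenport–Heilbronn 1971;
Bhargava–Shankar–Tsimerman, arXiv:1005.0672 §8.5: "by class field theory the number of triplets of
cubic fields `K₃` corresponding to a given `K₂` in this way equals `(h₃*(K₂) − 1)/2`";
Taniguchi–Thorne 2013 §6.1.) The finite-group half `#Cl₃ = 2·#{index-3 subgroups} + 1` is PROVED in
the tree (`ThreeTorsionProofs.quadFieldThreeTorsion_eq_two_mul_card_index_three_add_one`); the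
class-field-theoretic half (an unramified `C₃`-extension of `ℚ(√D)` for each index-`3` subgroup, and
conversely) is not in Mathlib. Here:

* `Hasse1930_threeTorsion_dictionary_neg` — the NAMED FACT, imaginary case, in the exact shape of
  the hypothesis `hCFT` of `ThreeTorsionBridge`: for every negative fundamental `D`,
  `quadFieldThreeTorsion D = 2 * cubicFieldCountOfDisc D + 1`;
* `three_dvd_classNumber_of_one_le_cubicFieldCountOfDisc` — PROVED from it: a cubic field of
  negative fundamental discriminant `D` forces `3 ∣ h(D)` (form class number
  `BinaryQuadraticForm.classNumber D = h(ℚ(√D))`, `card_reducedForms_eq_classNumber`) — the direction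
  "irreducible cubic form of fundamental discriminant ⇒ `3 ∣ h`" of Hasse's theorem used by
  reductions that PLANT cubic forms;
* `btt_threeTorsion_sum_neg_iff_fundCubicFieldCount'` — the bridge of `ThreeTorsionBridge` with its
  hypothesis supplied by the fact.

The real-quadratic analogue (positive fundamental `D`, where units intervene only in the count of
FIELDS versus 3-torsion through the same formula) is deliberately NOT filed here (one fact per
proposal, D-0026).

## References

* H. Hasse, *Arithmetische Theorie der kubischen Zahlkörper auf klassenkörpertheoretischer
  Grundlage*, Math. Z. 31 (1930) 565–582, doi:10.1007/bf01246435 [Hasse1930].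
* M. Bhargava, T. Taniguchi, F. Thorne, *Improved error estimates for the Davenport–Heilbronn
  theorems*, Math. Ann. 389 (2024) = arXiv:2107.12819, p. 3 [BhargavaTaniguchiThorne2023].
* M. Bhargava, A. Shankar, J. Tsimerman, *On the Davenport–Heilbronn theorems and second order
  terms*, Invent. Math. 193 (2013) = arXiv:1005.0672, §8.5 [BhargavaShankarTsimerman2012].
-/

noncomputable section

namespace Literature.NumberTheory.CubicFields

open Literature.NumberTheory.QuadraticFields

/-- **Hasse's dictionary, imaginary quadratic case (NAMED FACT; class field theory).** For every
negative fundamental discriminant `D` (here: `D ∈ negFundDiscrs X`, i.e. `−X < D < 0` fundamental),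
the number of `3`-torsion ideal classes of `ℚ(√D)` is `2 · #{cubic fields of discriminant D} + 1`:
`quadFieldThreeTorsion D = 2 * cubicFieldCountOfDisc D + 1`. Bhargava–Taniguchi–Thorne 2023, p. 3
("by class field theory … the cubic fields `K` with `Disc(K) = D` correspond to the index `3`
subgroups of `Cl(ℚ(√D))`"), after Hasse 1930 (Math. Z. 31); BST 2013 §8.5. Exactly the hypothesis
`hCFT` of `btt_threeTorsion_sum_neg_iff_fundCubicFieldCount` (`ThreeTorsionBridge.lean`).
[cite: BhargavaTaniguchiThorne2023, p. 3] -/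
def Hasse1930_threeTorsion_dictionary_neg : Prop :=
  ∀ X : ℕ, ∀ D ∈ negFundDiscrs X, quadFieldThreeTorsion D = 2 * cubicFieldCountOfDisc D + 1

/-- **A cubic field of negative fundamental discriminant `D` forces `3 ∣ h(D)`** (Hasse 1930, via
the dictionary): `#Cl₃(D) = 2c + 1 ≥ 3 > 1`, and `3 ∣ h(D) ↔ 1 < #Cl₃(D)`
(`three_dvd_classNumber_iff_one_lt_quadFieldThreeTorsion`, with the form class number
`BinaryQuadraticForm.classNumber D = h(ℚ(√D))`). PROVED from the named fact. [cite: BhargavaTaniguchiThorne2023, p. 3] -/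
theorem three_dvd_classNumber_of_one_le_cubicFieldCountOfDisc
    (hH : Hasse1930_threeTorsion_dictionary_neg) {D : ℤ}
    (hD : (D % 4 = 1 ∧ Squarefree D ∧ D ≠ 1) ∨
      (4 ∣ D ∧ (D / 4 % 4 = 2 ∨ D / 4 % 4 = 3) ∧ Squarefree (D / 4)))
    (hD0 : D < 0) (hc : 1 ≤ cubicFieldCountOfDisc D) :
    3 ∣ BinaryQuadraticForm.classNumber D := by
  have hmem : D ∈ negFundDiscrs (D.natAbs + 1) := by
    rw [mem_negFundDiscrs]
    refine ⟨⟨?_, hD0⟩, hD⟩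
    omega
  have ht := hH (D.natAbs + 1) D hmem
  rw [three_dvd_classNumber_iff_one_lt_quadFieldThreeTorsion hD hD0, ht]
  omega

/-- The bridge of `ThreeTorsionBridge.lean`, with its class-field-theoretic hypothesis supplied by
the named fact: the imaginary half of BTT Thm 1.2 is equivalent to the two-term asymptotic (3) for
`Σ_{−X<D<0 fund.} #{cubic fields of disc D}`. [cite: BhargavaTaniguchiThorne2023, p. 3] -/
theorem btt_threeTorsion_sum_neg_iff_fundCubicFieldCount'
    (hH : Hasse1930_threeTorsion_dictionary_neg) :
    (∃ K : ℝ, ∀ ε : ℝ, 0 < ε → ∃ C : ℝ, ∀ X : ℕ, 1 ≤ X →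
      |(∑ D ∈ negFundDiscrs X, (quadFieldThreeTorsion D : ℝ)) - 6 / Real.pi ^ 2 * X
          - K * (X : ℝ) ^ ((5 : ℝ) / 6)| ≤ C * (X : ℝ) ^ ((2 : ℝ) / 3 + ε)) ↔
    (∃ K : ℝ, ∀ ε : ℝ, 0 < ε → ∃ C : ℝ, ∀ X : ℕ, 1 ≤ X →
      |(∑ D ∈ negFundDiscrs X, (cubicFieldCountOfDisc D : ℝ)) - 3 / (2 * Real.pi ^ 2) * X
          - K * (X : ℝ) ^ ((5 : ℝ) / 6)| ≤ C * (X : ℝ) ^ ((2 : ℝ) / 3 + ε)) :=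
  btt_threeTorsion_sum_neg_iff_fundCubicFieldCount hH

end Literature.NumberTheory.CubicFields

end
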